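import Literature.NumberTheory.GaloisRepresentations.GaloisCohomologyUnitsInflationCocycle
import Literature.AnabelianGeometry.AbsoluteAnabelian.AbsAnabProp121viiHolds
import Literature.AlgebraicGeometry.Frobenioids.PadicKummerThm24iiFieldIso
import HarnessLib

/-!
# The local invariant map `inv_K : Br(K) ⥲ ℚ/ℤ` is preserved by isomorphisms of local fields:
# `inv_{K₂} ∘ T_Θ = inv_{K₁}` for `θ : K₁ ⥲ K₂` lifted to `Θ : K̄₁ ⥲ K̄₂`
# (Serre, *Local Fields* XI §1 (iv), XIII §3; Cassels–Fröhlich VI §1.1 "functoriality of `inv`")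

Topic `NumberTheory/GaloisRepresentations` (local class field theory); namespace
`Literature.NumberTheory.GaloisRepresentations.LocalBrauer`.  Definitions with bodies (the transport and its
bookkeeping morphisms) and theorems; NO named fact, no `sorry`, no instance, no notation.  Lane «TATE-EPC-TC» of
cell `bsd-eis` (crux `GoodLatticeBDPValue`, stmt-BirchSwinnertonDyer-19032), piece (θ-ii), file 1/2: the engine of
`LocalLayerInvariantBaseTransport.lean` (abstract layers) and `IdeleLocalInvariantsConjugation.lean` (idèles).

Mathematics.  For an isomorphism `θ : K₁ ⥲ K₂` of char-0 non-archimedean local fields identifying the valuation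
rings and a lift `Θ : K̄₁ ⥲ K̄₂` of it, the transport `T_Θ : Br(K₁) = H²(Γ_{K₁}, K̄₁ˣ) → H²(Γ_{K₂}, K̄₂ˣ) = Br(K₂)`
along the pair (`Γ_{K₂} ⥲ Γ_{K₁}`, `g ↦ Θ⁻¹ g Θ`; `Θ|ˣ`) — the tree's `Prop121vii.cohTransport` for the module `K̄ˣ`
(§1), with its cocycle formula (§2) — commutes with the Kummer maps `H²(Γ_K, μ_n) → H²(Γ_K, K̄ˣ)` (§3), hence
intertwines THE invariant maps `inv_{Kᵢ} = Prop121vii.brauerInvariantEquiv Kᵢ`, which are DEFINED through Kummer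
from THE residue maps `invLevel` (`brauerInvariantEquiv_kummer`), by [AbsAnab] Prop. 1.2.1 (vii) PROVED in the tree
(`galoisMLF_iso_residueMap_holds`) fed with Frobenioids II Thm. 2.4 (ii)'s field-isomorphism lemmas
(`Def22Context.Iso.isAlphaEquivariant/preservesAbsUnits/preservesUniformizers_unitsMapEquiv`) — the engine of
`LocalInvariantMapConjCompatible.lean` (there for `μ_N`-coefficients), here for `K̄ˣ` (§4).

## What is formalised (`K₁ K₂ : Type`)
* §1 `unitsCarrierMap`, `isEquivariantOver_unitsCarrierMap`, **`brauerTransport θ Θ hΘ`**.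
* §2 `transportResHom`, `transportCoeffHom`, `brauerTransport_twoCocycleClass_eq_pullback`,
  `brauerTransport_twoCocycleClass` (`T [c₁] = [c₂]` when `c₂(σ', τ') = Θ (c₁(Θ⁻¹σ'Θ, Θ⁻¹τ'Θ))`).
* §3 `muTransportResHom`, `muTransportCoeffHom`, `muTransport_twoCocycleClass_eq_pullback`,
  **`brauerTransport_cohomologyMap_kummerι`** (`T_{K̄ˣ} ∘ H²(μ_n ↪ K̄₁ˣ) = H²(μ_n ↪ K̄₂ˣ) ∘ T_{μ_n}`).
* §4 **`brauerInvariantEquiv_brauerTransport`**: `inv_{K₂} (T_Θ z) = inv_{K₁} z` (valuative `θ`).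

HONEST FRAMING: classical local class field theory; no statement of a Summit, of Tate's theorem or of the crux is
proved here; 0 cells / labels / tiers move.

## References
* J.-P. Serre, *Local Fields*, GTM 67 (1979), Ch. XI §1 (iv), Ch. XIII §3. [SerreLocalFields1979]
* J.-P. Serre, *Galois Cohomology* (1997), Ch. I §2.4, Ch. II §1.2. [SerreGaloisCohomology1997]
* J. W. S. Cassels, A. Fröhlich (eds.), *Algebraic Number Theory* (1967), Ch. VI §1.1, Ch. VII §1.1. [CasselsFrohlichANT1967]
* S. Mochizuki, *The absolute anabelian geometry of hyperbolic curves* (2004), Prop. 1.2.1 (vii). [MochizukiAbsAnab2004]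
* S. Mochizuki, *The geometry of Frobenioids II* (2008), Thm. 2.4 (i)–(ii). [MochizukiFrdII2008]
-/

noncomputable section

open CategoryTheory groupCohomology Function Field

namespace Literature.NumberTheory.GaloisRepresentations

namespace LocalBrauer

open DiscreteGaloisModule Literature.Algebra.Homology
open _root_.ContinuousCohomology
open Literature.AnabelianGeometry.AbsoluteAnabelian
open Literature.AnabelianGeometry.AbsoluteAnabelian.Prop121vii
open Literature.AlgebraicGeometry.Frobenioids.PadicKummer
open scoped ValuativeRel

-- Explicit `2`-cocycle classes need `LocallyCompactSpace Γ_K`; the tree's theorem (every field) is the only source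
-- of it.  Local to this file, no override (as in `GaloisCohomologyUnitsInflationCocycle.lean`).
attribute [local instance] absoluteGaloisGroup_compactSpace

/-! ## §1. The transport on `Br(K) = H²(Γ_K, K̄ˣ)` along an isomorphism of base fields -/

section Brauer

variable {K₁ K₂ : Type} [Field K₁] [Field K₂] (θ : K₁ ≃+* K₂)
  (Θ : AlgebraicClosure K₁ ≃+* AlgebraicClosure K₂)
  (hΘ : ∀ x : K₁, Θ (algebraMap K₁ (AlgebraicClosure K₁) x) = algebraMap K₂ (AlgebraicClosure K₂) (θ x))

/-- A homomorphism `ψ : K̄₁ˣ → K̄₂ˣ` on the additive carriers of the discrete modules `K̄ᵢˣ` (`units Kᵢ`).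
[cite: SerreLocalFields1979, Ch. XI §1 (iv)] -/
def unitsCarrierMap (ψ : (AlgebraicClosure K₁)ˣ →* (AlgebraicClosure K₂)ˣ) : UnitsCarrier K₁ →+ UnitsCarrier K₂ :=
  ((UnitsCarrier.toAdditive (K := K₂)).symm.toAddMonoidHom.comp (MonoidHom.toAdditive ψ)).comp
    (UnitsCarrier.toAdditive (K := K₁)).toAddMonoidHom

/-- `unitsCarrierMap ψ` on underlying units is `ψ`. [cite: SerreLocalFields1979, Ch. XI §1 (iv)] -/
@[simp] theorem unitsVal_unitsCarrierMap (ψ : (AlgebraicClosure K₁)ˣ →* (AlgebraicClosure K₂)ˣ) (u : UnitsCarrier K₁) :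
    unitsVal K₂ (unitsCarrierMap ψ u) = ψ (unitsVal K₁ u) := rfl

/-- `unitsCarrierMap ψ (ofUnits x) = ofUnits (ψ x)`. [cite: SerreLocalFields1979, Ch. XI §1 (iv)] -/
@[simp] theorem unitsCarrierMap_ofUnits (ψ : (AlgebraicClosure K₁)ˣ →* (AlgebraicClosure K₂)ˣ)
    (x : (AlgebraicClosure K₁)ˣ) : unitsCarrierMap ψ (UnitsCarrier.ofUnits x) = UnitsCarrier.ofUnits (ψ x) := rfl

/-- **`Θ|ˣ : K̄₁ˣ → K̄₂ˣ` is equivariant along `Γ_{K₁} ⥲ Γ_{K₂}`, `σ ↦ Θ σ Θ⁻¹`** (`galConjₜ`; Frobenioids II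
Thm. 2.4 (ii) `isAlphaEquivariant_unitsMapEquiv`, read on the carriers of `units Kᵢ`).
[cite: MochizukiFrdII2008, Thm 2.4 (i) p.19] -/
theorem isEquivariantOver_unitsCarrierMap :
    IsEquivariantOver (galConjₜ θ Θ hΘ) (units K₁) (units K₂)
      (unitsCarrierMap (Units.mapEquiv Θ.toMulEquiv).toMonoidHom) := by
  intro σ m
  apply unitsVal_injective K₂
  rw [unitsVal_unitsCarrierMap, unitsVal_apply, unitsVal_apply, unitsVal_unitsCarrierMap]
  exact Def22Context.Iso.isAlphaEquivariant_unitsMapEquiv θ Θ hΘ σ (unitsVal K₁ m)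

/-- **The transport `Br(K₁) = H²(Γ_{K₁}, K̄₁ˣ) → H²(Γ_{K₂}, K̄₂ˣ) = Br(K₂)`** along the isomorphism of local
fields `θ : K₁ ⥲ K₂` lifted to `Θ : K̄₁ ⥲ K̄₂`: pull back along `Γ_{K₂} ⥲ Γ_{K₁}`, `g ↦ Θ⁻¹ g Θ`, and push the
coefficients along `Θ|ˣ` (the tree's `Prop121vii.cohTransport` for the module `K̄ˣ`).
[cite: SerreLocalFields1979, Ch. XI §1 (iv)][cite: MochizukiAbsAnab2004, Prop 1.2.1 (vii) p.11] -/
def brauerTransport : galoisCohomology (units K₁) 2 →+ galoisCohomology (units K₂) 2 :=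
  cohTransport (galConjₜ θ Θ hΘ) (units K₁) (units K₂) (unitsCarrierMap (Units.mapEquiv Θ.toMulEquiv).toMonoidHom)
    (isEquivariantOver_unitsCarrierMap θ Θ hΘ) 2

/-! ## §2. The cocycle formula of the transport -/

/-- The identity of `K̄₁ˣ` as a morphism `res_{α⁻¹} K̄₁ˣ ⟶ (K̄₁ˣ restricted along α⁻¹)` (bookkeeping for
`ContinuousCohomology.map`). [cite: SerreGaloisCohomology1997, I §2.4] -/
def transportResHom :
    TopRep.res (((galConjₜ θ Θ hΘ).symm : absoluteGaloisGroup K₂ →ₜ* absoluteGaloisGroup K₁) :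
        absoluteGaloisGroup K₂ →* absoluteGaloisGroup K₁) (units K₁).toTopRep ⟶
      DiscreteGaloisModule.toTopRep (ContinuousRep.restrict (units K₁)
        ((galConjₜ θ Θ hΘ).symm : absoluteGaloisGroup K₂ →ₜ* absoluteGaloisGroup K₁)) :=
  TopRep.ofHom ⟨ContinuousLinearMap.id ℤ (UnitsCarrier K₁), fun _ => rfl⟩

/-- The coefficient morphism `Θ|ˣ : (K̄₁ˣ restricted along α⁻¹) ⟶ K̄₂ˣ` over the identity of `Γ_{K₂}`.
[cite: SerreGaloisCohomology1997, I §2.4] -/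
def transportCoeffHom :
    TopRep.res ((ContinuousMonoidHom.id (absoluteGaloisGroup K₂) :
        absoluteGaloisGroup K₂ →ₜ* absoluteGaloisGroup K₂) : absoluteGaloisGroup K₂ →* absoluteGaloisGroup K₂)
        (DiscreteGaloisModule.toTopRep (ContinuousRep.restrict (units K₁)
          ((galConjₜ θ Θ hΘ).symm : absoluteGaloisGroup K₂ →ₜ* absoluteGaloisGroup K₁))) ⟶
      (units K₂).toTopRep :=
  TopRep.ofHom ⟨(intertwiningOfEquivariant (galConjₜ θ Θ hΘ) (units K₁) (units K₂)
      (unitsCarrierMap (Units.mapEquiv Θ.toMulEquiv).toMonoidHom)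
      (isEquivariantOver_unitsCarrierMap θ Θ hΘ)).toContinuousLinearMap,
    (intertwiningOfEquivariant (galConjₜ θ Θ hΘ) (units K₁) (units K₂)
      (unitsCarrierMap (Units.mapEquiv Θ.toMulEquiv).toMonoidHom)
      (isEquivariantOver_unitsCarrierMap θ Θ hΘ)).isIntertwining'⟩

/-- **The transport on explicit `2`-cocycles**: `T [c] = [(σ', τ') ↦ Θ (c (α⁻¹σ', α⁻¹τ'))]`, as the class of the
iterated pullback (Mathlib functoriality, the tree's `map_twoCocycleClass`).
[cite: SerreGaloisCohomology1997, I §2.4][cite: MochizukiAbsAnab2004, Prop 1.2.1 (vii) p.11] -/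
theorem brauerTransport_twoCocycleClass_eq_pullback (c : contTwoCocycles (units K₁).toTopRep) :
    brauerTransport θ Θ hΘ (twoCocycleClass _ c) =
      twoCocycleClass _ (contTwoCocycles.pullback (ContinuousMonoidHom.id _) (transportCoeffHom θ Θ hΘ)
        (contTwoCocycles.pullback ((galConjₜ θ Θ hΘ).symm : absoluteGaloisGroup K₂ →ₜ* absoluteGaloisGroup K₁)
          (transportResHom θ Θ hΘ) c)) := by
  show (ContinuousCohomology.map (ContinuousMonoidHom.id _) (transportCoeffHom θ Θ hΘ) 2)
      ((ContinuousCohomology.map ((galConjₜ θ Θ hΘ).symm : absoluteGaloisGroup K₂ →ₜ* absoluteGaloisGroup K₁)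
        (transportResHom θ Θ hΘ) 2) (twoCocycleClass _ c)) = _
  rw [map_twoCocycleClass, map_twoCocycleClass]

/-- Values of the transported cocycle: `Θ (c (α⁻¹σ', α⁻¹τ'))`. [cite: SerreGaloisCohomology1997, I §2.4] -/
theorem unitsVal_transport_pullback_apply (c : contTwoCocycles (units K₁).toTopRep) (σ' τ' : absoluteGaloisGroup K₂) :
    unitsVal K₂ ((contTwoCocycles.pullback (ContinuousMonoidHom.id _) (transportCoeffHom θ Θ hΘ)
        (contTwoCocycles.pullback ((galConjₜ θ Θ hΘ).symm : absoluteGaloisGroup K₂ →ₜ* absoluteGaloisGroup K₁)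
          (transportResHom θ Θ hΘ) c)).1 (σ', τ')) =
      Units.mapEquiv Θ.toMulEquiv (unitsVal K₁ (c.1 ((galConjₜ θ Θ hΘ).symm σ', (galConjₜ θ Θ hΘ).symm τ'))) := by
  rw [contTwoCocycles.pullback_apply, contTwoCocycles.pullback_apply]
  rfl

/-- **Cocycle formula**: `T [c₁] = [c₂]` for every continuous `2`-cocycle `c₂` of `K̄₂ˣ` with
`c₂(σ', τ') = Θ (c₁(α⁻¹σ', α⁻¹τ'))`. [cite: SerreGaloisCohomology1997, I §2.4][cite: MochizukiAbsAnab2004, Prop 1.2.1 (vii) p.11] -/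
theorem brauerTransport_twoCocycleClass (c₁ : contTwoCocycles (units K₁).toTopRep)
    (c₂ : contTwoCocycles (units K₂).toTopRep)
    (hc : ∀ σ' τ' : absoluteGaloisGroup K₂, unitsVal K₂ (c₂.1 (σ', τ')) =
      Units.mapEquiv Θ.toMulEquiv (unitsVal K₁ (c₁.1 ((galConjₜ θ Θ hΘ).symm σ', (galConjₜ θ Θ hΘ).symm τ')))) :
    brauerTransport θ Θ hΘ (twoCocycleClass _ c₁) = twoCocycleClass _ c₂ := by
  rw [brauerTransport_twoCocycleClass_eq_pullback]
  refine congrArg (twoCocycleClass _) (Subtype.ext (ContinuousMap.ext fun p => ?_))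
  obtain ⟨σ', τ'⟩ := p
  apply unitsVal_injective K₂
  rw [unitsVal_transport_pullback_apply, hc]

/-! ## §3. The transport commutes with the Kummer maps `H²(Γ_K, μ_n) → H²(Γ_K, K̄ˣ)` -/

/-- `H²(kummerι) [c] = [kummerι ∘ c]` (functoriality on explicit cocycles). [cite: SerreGaloisCohomology1997, I §2.4] -/
theorem cohomologyMap_kummerι_twoCocycleClass (K : Type) [Field K] (n : ℕ) (c : contTwoCocycles (mu K n).toTopRep) :
    cohomologyMap (kummerι K n) 2 (twoCocycleClass _ c) =
      twoCocycleClass _ (contTwoCocycles.pullback (ContinuousMonoidHom.id _) (resIdHom (kummerι K n)) c) :=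
  map_twoCocycleClass _ _ _ c

/-- The identity of `μ_n(K̄₁)` as a morphism `res_{α⁻¹} μ_n ⟶ (μ_n restricted along α⁻¹)` (bookkeeping).
[cite: SerreGaloisCohomology1997, I §2.4] -/
def muTransportResHom (n : ℕ) :
    TopRep.res (((galConjₜ θ Θ hΘ).symm : absoluteGaloisGroup K₂ →ₜ* absoluteGaloisGroup K₁) :
        absoluteGaloisGroup K₂ →* absoluteGaloisGroup K₁) (mu K₁ n).toTopRep ⟶
      DiscreteGaloisModule.toTopRep (ContinuousRep.restrict (mu K₁ n)
        ((galConjₜ θ Θ hΘ).symm : absoluteGaloisGroup K₂ →ₜ* absoluteGaloisGroup K₁)) :=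
  TopRep.ofHom ⟨ContinuousLinearMap.id ℤ (MuCarrier K₁ n), fun _ => rfl⟩

/-- The coefficient morphism `Θ|μ_n : (μ_n(K̄₁) restricted along α⁻¹) ⟶ μ_n(K̄₂)` over the identity of `Γ_{K₂}`.
[cite: SerreGaloisCohomology1997, I §2.4] -/
def muTransportCoeffHom (n : ℕ) :
    TopRep.res ((ContinuousMonoidHom.id (absoluteGaloisGroup K₂) :
        absoluteGaloisGroup K₂ →ₜ* absoluteGaloisGroup K₂) : absoluteGaloisGroup K₂ →* absoluteGaloisGroup K₂)
        (DiscreteGaloisModule.toTopRep (ContinuousRep.restrict (mu K₁ n)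
          ((galConjₜ θ Θ hΘ).symm : absoluteGaloisGroup K₂ →ₜ* absoluteGaloisGroup K₁))) ⟶
      (mu K₂ n).toTopRep :=
  TopRep.ofHom ⟨(intertwiningOfEquivariant (galConjₜ θ Θ hΘ) (mu K₁ n) (mu K₂ n)
      (muCarrierMap (Units.mapEquiv Θ.toMulEquiv).toMonoidHom n)
      (isEquivariantOver_muCarrierMap (Def22Context.Iso.isAlphaEquivariant_unitsMapEquiv θ Θ hΘ) n)).toContinuousLinearMap,
    (intertwiningOfEquivariant (galConjₜ θ Θ hΘ) (mu K₁ n) (mu K₂ n)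
      (muCarrierMap (Units.mapEquiv Θ.toMulEquiv).toMonoidHom n)
      (isEquivariantOver_muCarrierMap (Def22Context.Iso.isAlphaEquivariant_unitsMapEquiv θ Θ hΘ) n)).isIntertwining'⟩

/-- The tree's `cohTransport` on `μ_n` along `(α, Θ|μ_n)` on explicit cocycles, as the class of the iterated pullback.
[cite: MochizukiAbsAnab2004, Prop 1.2.1 (vii) p.11][cite: SerreGaloisCohomology1997, I §2.4] -/
theorem muTransport_twoCocycleClass_eq_pullback (n : ℕ) (c : contTwoCocycles (mu K₁ n).toTopRep) :
    cohTransport (galConjₜ θ Θ hΘ) (mu K₁ n) (mu K₂ n) (muCarrierMap (Units.mapEquiv Θ.toMulEquiv).toMonoidHom n)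
        (isEquivariantOver_muCarrierMap (Def22Context.Iso.isAlphaEquivariant_unitsMapEquiv θ Θ hΘ) n) 2
        (twoCocycleClass _ c) =
      twoCocycleClass _ (contTwoCocycles.pullback (ContinuousMonoidHom.id _) (muTransportCoeffHom θ Θ hΘ n)
        (contTwoCocycles.pullback ((galConjₜ θ Θ hΘ).symm : absoluteGaloisGroup K₂ →ₜ* absoluteGaloisGroup K₁)
          (muTransportResHom θ Θ hΘ n) c)) := by
  show (ContinuousCohomology.map (ContinuousMonoidHom.id _) (muTransportCoeffHom θ Θ hΘ n) 2)
      ((ContinuousCohomology.map ((galConjₜ θ Θ hΘ).symm : absoluteGaloisGroup K₂ →ₜ* absoluteGaloisGroup K₁)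
        (muTransportResHom θ Θ hΘ n) 2) (twoCocycleClass _ c)) = _
  rw [map_twoCocycleClass, map_twoCocycleClass]

/-- Values of the transported `μ_n`-cocycle, in `K̄₂ˣ`: `Θ (c (α⁻¹σ', α⁻¹τ'))`. [cite: SerreGaloisCohomology1997, I §2.4] -/
theorem muVal_muTransport_pullback_apply (n : ℕ) (c : contTwoCocycles (mu K₁ n).toTopRep)
    (σ' τ' : absoluteGaloisGroup K₂) :
    muVal K₂ n ((contTwoCocycles.pullback (ContinuousMonoidHom.id _) (muTransportCoeffHom θ Θ hΘ n)
        (contTwoCocycles.pullback ((galConjₜ θ Θ hΘ).symm : absoluteGaloisGroup K₂ →ₜ* absoluteGaloisGroup K₁)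
          (muTransportResHom θ Θ hΘ n) c)).1 (σ', τ')) =
      Units.mapEquiv Θ.toMulEquiv (muVal K₁ n (c.1 ((galConjₜ θ Θ hΘ).symm σ', (galConjₜ θ Θ hΘ).symm τ'))) := by
  rw [contTwoCocycles.pullback_apply, contTwoCocycles.pullback_apply]
  rfl

/-- Values of `kummerι ∘ c` in `K̄ˣ` are the values of `c`. [cite: SerreGaloisCohomology1997, II §1.2] -/
theorem unitsVal_kummerι_pullback_apply (K : Type) [Field K] (n : ℕ) (c : contTwoCocycles (mu K n).toTopRep)
    (σ τ : absoluteGaloisGroup K) :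
    unitsVal K ((contTwoCocycles.pullback (ContinuousMonoidHom.id _) (resIdHom (kummerι K n)) c).1 (σ, τ)) =
      muVal K n (c.1 (σ, τ)) := by
  rw [contTwoCocycles.pullback_apply]
  rfl

/-- **Kummer naturality of the transports**: `T_{K̄ˣ} ∘ H²(μ_n ↪ K̄₁ˣ) = H²(μ_n ↪ K̄₂ˣ) ∘ T_{μ_n}`, where `T_{μ_n}`
is the tree's `cohTransport` along `(α, Θ|μ_n)` (both sides are classes of cocycles with the same values
`Θ (c (α⁻¹σ', α⁻¹τ'))`). [cite: MochizukiAbsAnab2004, Prop 1.2.1 (vii) p.11][cite: SerreGaloisCohomology1997, I §2.4] -/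
theorem brauerTransport_cohomologyMap_kummerι (n : ℕ) (x : galoisCohomology (mu K₁ n) 2) :
    brauerTransport θ Θ hΘ (cohomologyMap (kummerι K₁ n) 2 x) =
      cohomologyMap (kummerι K₂ n) 2
        (cohTransport (galConjₜ θ Θ hΘ) (mu K₁ n) (mu K₂ n)
          (muCarrierMap (Units.mapEquiv Θ.toMulEquiv).toMonoidHom n)
          (isEquivariantOver_muCarrierMap (Def22Context.Iso.isAlphaEquivariant_unitsMapEquiv θ Θ hΘ) n) 2 x) := by
  obtain ⟨c, rfl⟩ := twoCocycleClass_surjective _ x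
  rw [muTransport_twoCocycleClass_eq_pullback, cohomologyMap_kummerι_twoCocycleClass,
    cohomologyMap_kummerι_twoCocycleClass]
  refine brauerTransport_twoCocycleClass θ Θ hΘ _ _ fun σ' τ' => ?_
  rw [unitsVal_kummerι_pullback_apply, unitsVal_kummerι_pullback_apply, muVal_muTransport_pullback_apply]

end Brauer

/-! ## §4. `inv_{K₂} ∘ T = inv_{K₁}` ([AbsAnab] Prop. 1.2.1 (vii), through Kummer) -/

section Invariant

variable {K₁ K₂ : Type} [Field K₁] [ValuativeRel K₁] [TopologicalSpace K₁] [IsNonarchimedeanLocalField K₁]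
  [CharZero K₁] [Field K₂] [ValuativeRel K₂] [TopologicalSpace K₂] [IsNonarchimedeanLocalField K₂] [CharZero K₂]
  (θ : K₁ ≃+* K₂) (Θ : AlgebraicClosure K₁ ≃+* AlgebraicClosure K₂)
  (hΘ : ∀ x : K₁, Θ (algebraMap K₁ (AlgebraicClosure K₁) x) = algebraMap K₂ (AlgebraicClosure K₂) (θ x))
  (hO : ∀ x : K₁, x ∈ 𝒪[K₁] ↔ θ x ∈ 𝒪[K₂])

include hO in
/-- **THE local invariant maps are preserved by the transport along an isomorphism of local fields identifying the
valuation rings**: `inv_{K₂} (T z) = inv_{K₁} z` on `Br(K₁) = H²(Γ_{K₁}, K̄₁ˣ)`.  Every Brauer class is the Kummer image of a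
class of some level `n` (`exists_cohomologyMap_kummerι_eq`); `inv_K` is `inv_n/n` there (`brauerInvariantEquiv_kummer`);
the transport commutes with Kummer (§3) and intertwines THE residue maps `inv_n` ([AbsAnab] Prop. 1.2.1 (vii) PROVED,
`galoisMLF_iso_residueMap_holds`, fed with Frobenioids II Thm. 2.4 (ii)'s field-isomorphism lemmas).
[cite: SerreLocalFields1979, Ch. XIII §3][cite: MochizukiAbsAnab2004, Prop 1.2.1 (vii) p.11][cite: CasselsFrohlichANT1967, Ch. VI §1.1] -/
theorem brauerInvariantEquiv_brauerTransport (z : galoisCohomology (units K₁) 2) :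
    brauerInvariantEquiv K₂ (brauerTransport θ Θ hΘ z) = brauerInvariantEquiv K₁ z := by
  obtain ⟨n, x, rfl⟩ := exists_cohomologyMap_kummerι_eq z
  rw [brauerTransport_cohomologyMap_kummerι, brauerInvariantEquiv_kummer, brauerInvariantEquiv_kummer]
  have hres := galoisMLF_iso_residueMap_holds K₁ K₂ (galConjₜ θ Θ hΘ) (Units.mapEquiv Θ.toMulEquiv) (n : ℕ)
    (Def22Context.Iso.isAlphaEquivariant_unitsMapEquiv θ Θ hΘ)
    (Def22Context.Iso.preservesAbsUnits_unitsMapEquiv θ Θ hΘ hO)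
    (Def22Context.Iso.preservesUniformizers_unitsMapEquiv θ Θ hΘ hO)
    (invLevel K₁ (n : ℕ)) (invLevel K₂ (n : ℕ)) (isInvariantMap_invLevel K₁ (n : ℕ)) (isInvariantMap_invLevel K₂ (n : ℕ))
  have hx := congrArg (fun f => f x) hres
  simp only [AddMonoidHom.coe_comp, Function.comp_apply] at hx
  rw [hx]

end Invariant

end LocalBrauer

end Literature.NumberTheory.GaloisRepresentations

end
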